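import Literature.MathematicalPhysics.KineticTheory.HardSphereEulerContinuousDependenceProofs
import Literature.MathematicalPhysics.KineticTheory.HardSphereEulerLocalExistence
import Literature.MathematicalPhysics.KineticTheory.HardSphereEulerContinuationHolds
import Literature.MathematicalPhysics.KineticTheory.HardSphereEulerClassicalUniqueness
import Literature.MathematicalPhysics.KineticTheory.HardSphereEulerTwoEosStability
import Literature.MathematicalPhysics.KineticTheory.HardSphereEulerStabilityEstimate
import Literature.MathematicalPhysics.KineticTheory.HardSphereEulerUniformDerivEnergy
import Literature.Analysis.FluidPDE.CompressibleEulerDerivEnergyDataBound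
import Literature.Analysis.FunctionSpaces.TorusSmallnessInterpolation
import HarnessLib

/-!
# Kato's continuous-dependence theorem for the hard-sphere Euler family holds:
# `hsEuler_continuousDependence_holds`

MathematicalPhysics/KineticTheory proof file (theorems only; no definitions, no named facts): the
DISCHARGE of the named fact `hsEuler_continuousDependence` (`HardSphereEulerContinuousDependence.lean`,
T. Kato, ARMA 58 (1975), Thm III, rendered for the one-parameter family `p_σ = ρθZ(ρσ³)` of
hard-sphere Euler systems on `𝕋³` at its ideal-gas end `σ = 0`). The assembly
`hsEuler_continuousDependence_of_localTheory` (`HardSphereEulerContinuousDependenceProofs.lean`)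
reduces the fact to four layers; all four are now theorems of the tree:

1. local existence — `hsEuler_localExistence_holds` (`HardSphereEulerLocalExistence.lean`);
2. continuation — `hsEuler_continuation_holds` (`HardSphereEulerContinuationHolds.lean`);
3. uniqueness at small packing — `hsEuler_uniqueness_smallPacking`
   (`HardSphereEulerClassicalUniqueness.lean`);
4. the fixed-horizon a-priori stability estimate — `hsEuler_stabilityEstimate` below, which is
   `HsEulerStability.stabilityEstimate_of_level0` (`HardSphereEulerStabilityEstimate.lean`: the
   bootstrap) fed with its four inputs: the `σ`-uniform level-0 relative-energy stability
   `HsEulerStability.hsEuler_twoEos_level0_stability` (`HardSphereEulerTwoEosStability.lean`), the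
   smallness interpolation `Torus.smallness_interpolation_three` (`TorusSmallnessInterpolation.lean`),
   the `σ`-uniform homogeneous `H³` energy inequality `hsEuler_uniformDerivEnergy`
   (`HardSphereEulerUniformDerivEnergy.lean`) and the data bound
   `CompressibleEuler.derivLevelEnergy_three_le_of_pointwise` (`CompressibleEulerDerivEnergyDataBound.lean`).

No hypothesis beyond those of the fact itself remains: the equation-of-state hypothesis
(`hsExcessFreeEnergy` analytic at small packing) is part of the statement of the fact.

## References

* T. Kato, *The Cauchy problem for quasi-linear symmetric hyperbolic systems*, Arch. Rational
  Mech. Anal. 58 (1975) 181–205: Thms I–III. [`Kato1975`]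
* A. Majda, *Compressible Fluid Flow and Systems of Conservation Laws in Several Space
  Variables*, Appl. Math. Sci. 53, Springer 1984: Ch. 2, §2.1, Thms 2.1–2.2. [`Majda1984`]
* C. M. Dafermos, *Hyperbolic Conservation Laws in Continuum Physics*, 2nd ed. (2005), Ch. V,
  Thms 5.1.1, 5.2.1. [`Dafermos2005`]
-/

noncomputable section

open Set MeasureTheory

namespace Literature.MathematicalPhysics.KineticTheory

open Literature.Analysis.FunctionSpaces Literature.Analysis.FluidPDE

/-- **Layer 4: the fixed-horizon a-priori stability estimate** (the hypothesis `hstab` of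
`hsEuler_continuousDependence_of_localTheory`): under the equation-of-state hypothesis, for every
classical ideal-gas reference solution on `[0, T₁)`, every `0 < T' < T₁` and `ε > 0` there are
`k`, `δ > 0`, `M > 0` such that for `0 < σ < δ` and smooth positive data `δ`-close in `Cᵏ` to the
reference data, EVERY classical `σ`-solution with these data on `[0, T)`, `T ≤ T'`, obeys
`M⁻¹ ≤ ρ, θ ≤ M`, `‖u‖ ≤ M`, `|∂ᵢ(ρ, u, θ)| ≤ M` and is `ε`-close to the reference pointwise on
`[0, T) × 𝕋³` (the bootstrap `HsEulerStability.stabilityEstimate_of_level0` with its four inputs).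
[cite: Kato1975, Thm III] -/
theorem hsEuler_stabilityEstimate :
    ∀ η₀ : ℝ, 0 < η₀ → ∀ F : ℝ → ℝ, AnalyticOnNhd ℝ F (Ioo (-η₀) η₀) →
      EqOn hsExcessFreeEnergy F (Ico 0 η₀) →
      ∀ (T₁ : ℝ) (ρ₁ θ₁ : ℝ → T3 → ℝ) (u₁ : ℝ → T3 → V3), IsHardSphereEulerSolution 0 T₁ ρ₁ u₁ θ₁ →
        ∀ T' : ℝ, 0 < T' → T' < T₁ → ∀ ε : ℝ, 0 < ε →
        ∃ k : ℕ, ∃ δ M : ℝ, 0 < δ ∧ 0 < M ∧ ∀ σ : ℝ, 0 < σ → σ < δ →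
          ∀ (ρ₀ θ₀ : T3 → ℝ) (u₀ : T3 → V3),
            Torus.IsSmooth ρ₀ → Torus.IsSmooth θ₀ → Torus.IsSmooth u₀ →
            (∀ x, 0 < ρ₀ x) → (∀ x, 0 < θ₀ x) →
            (∀ n : ℕ, n ≤ k → ∀ y : EuclideanSpace ℝ (Fin 3),
              ‖iteratedFDeriv ℝ n (Torus.lift fun x => ρ₀ x - ρ₁ 0 x) y‖ ≤ δ) →
            (∀ n : ℕ, n ≤ k → ∀ y : EuclideanSpace ℝ (Fin 3),
              ‖iteratedFDeriv ℝ n (Torus.lift fun x => θ₀ x - θ₁ 0 x) y‖ ≤ δ) →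
            (∀ n : ℕ, n ≤ k → ∀ y : EuclideanSpace ℝ (Fin 3),
              ‖iteratedFDeriv ℝ n (Torus.lift fun x => u₀ x - u₁ 0 x) y‖ ≤ δ) →
            ∀ T : ℝ, T ≤ T' → ∀ (ρ θ : ℝ → T3 → ℝ) (u : ℝ → T3 → V3),
              IsHardSphereEulerSolution σ T ρ u θ → ρ 0 = ρ₀ → u 0 = u₀ → θ 0 = θ₀ →
              ∀ t ∈ Ico 0 T, ∀ x,
                (M⁻¹ ≤ ρ t x ∧ ρ t x ≤ M ∧ M⁻¹ ≤ θ t x ∧ θ t x ≤ M ∧ ‖u t x‖ ≤ M ∧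
                  ∀ i : Fin 3, ‖Torus.partialDeriv i (u t) x‖ ≤ M ∧
                    |Torus.partialDeriv i (ρ t) x| ≤ M ∧ |Torus.partialDeriv i (θ t) x| ≤ M) ∧
                (|ρ t x - ρ₁ t x| < ε ∧ ‖u t x - u₁ t x‖ < ε ∧ |θ t x - θ₁ t x| < ε) :=
  HsEulerStability.stabilityEstimate_of_level0 HsEulerStability.hsEuler_twoEos_level0_stability
    Torus.smallness_interpolation_three hsEuler_uniformDerivEnergy CompressibleEuler.derivLevelEnergy_three_le_of_pointwise

/-- **`hsEuler_continuousDependence` holds** (Kato 1975, Thm III for the hard-sphere Euler family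
at `σ = 0`): layers 1–4 of the tree assembled by `hsEuler_continuousDependence_of_localTheory`.
[cite: Kato1975, Thm III] -/
theorem hsEuler_continuousDependence_holds : hsEuler_continuousDependence :=
  hsEuler_continuousDependence_of_localTheory hsEuler_localExistence_holds hsEuler_continuation_holds
    hsEuler_uniqueness_smallPacking hsEuler_stabilityEstimate

end Literature.MathematicalPhysics.KineticTheory

end
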